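import Mathlib
import Summits.Langlands.Langlands.Theorems.SoloBlindCyclicPowers

/-!
# Eighth powers modulo `p ≡ 1 (mod 8)`: `−4` is an eighth power iff `2^((p−1)/4) = (−1)^((p−1)/8)`

Solo side programme O1b (four-cell law, cell `(a₂, a_N) = (−, −)`): for a prime `N ≡ 1 (mod 8)` the
cell is non-trivial exactly when `(2/N)₄ = (−1)^((N−1)/8)`, i.e. `2^((N−1)/4) ≡ (−1)^((N−1)/8)`;
classically this is the condition `8 ∣ h(−4N)`, and in residue-symbol form it says that `−4` is an
eighth power modulo `N`.  This file proves the last equivalence from the cyclic-group criterion of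
`SoloBlindCyclicPowers`: in `(ZMod p)ˣ` (cyclic of order `p − 1`, `8 ∣ p − 1`) a unit is an eighth
power iff its `((p−1)/8)`-th power is `1`, and `(−4)^((p−1)/8) = (−1)^((p−1)/8) · 2^((p−1)/4)`.
-/

set_option linter.dupNamespace false

namespace Summit.Langlands.Langlands.Theorems.SoloBlindEighthPowers

open Summit.Langlands.Langlands.Theorems.SoloBlindCyclicPowers

/-- Euler's criterion for eighth powers: for a prime `p` with `8 ∣ p − 1`, a unit is an eighth
power iff its `((p − 1)/8)`-th power is `1`. -/
theorem exists_pow_eight_eq_iff {p : ℕ} [Fact p.Prime] (h8 : 8 ∣ p - 1) (x : (ZMod p)ˣ) :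
    (∃ y : (ZMod p)ˣ, y ^ 8 = x) ↔ x ^ ((p - 1) / 8) = 1 := by
  have hcard : Fintype.card (ZMod p)ˣ = p - 1 := ZMod.card_units p
  have hk : 8 ∣ Fintype.card (ZMod p)ˣ := by rw [hcard]; exact h8
  rw [exists_pow_eq_iff_pow_div_eq_one x hk, hcard]

/-- The ring identity behind the `(−,−)` criterion: `(−4)^k = (−1)^k · 2^(2k)`. -/
theorem neg_four_pow (R : Type*) [CommRing R] (k : ℕ) :
    ((-4 : R)) ^ k = (-1) ^ k * 2 ^ (2 * k) := by
  rw [pow_mul, show ((2 : R)) ^ 2 = 4 by norm_num, ← mul_pow]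
  congr 1; ring

/-- For a prime `p ≡ 1 (mod 8)`: `−4` is an eighth power modulo `p` iff
`2^((p−1)/4) = (−1)^((p−1)/8)` in `ZMod p` (i.e. `(2/p)₄ = (−1)^((p−1)/8)`). -/
theorem exists_pow_eight_eq_neg_four_iff {p : ℕ} [Fact p.Prime] (hp : p % 8 = 1) :
    (∃ y : ZMod p, y ^ 8 = -4) ↔ (2 : ZMod p) ^ ((p - 1) / 4) = (-1) ^ ((p - 1) / 8) := by
  have hprime : p.Prime := Fact.out
  have hp2 : p ≠ 2 := by intro h; subst h; norm_num at hp
  have h8 : 8 ∣ p - 1 := by omega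
  have h2ne : (2 : ZMod p) ≠ 0 := by
    have h : ((2 : ℕ) : ZMod p) ≠ 0 := by
      rw [ne_eq, ZMod.natCast_eq_zero_iff]
      intro hd
      exact hp2 ((Nat.prime_dvd_prime_iff_eq hprime Nat.prime_two).mp hd)
    exact_mod_cast h
  have h4ne : (-4 : ZMod p) ≠ 0 := by
    have : (-4 : ZMod p) = -(2 * 2) := by norm_num
    rw [this, neg_ne_zero]
    exact mul_ne_zero h2ne h2ne
  -- pass to units
  set u : (ZMod p)ˣ := Units.mk0 (-4 : ZMod p) h4ne with hu
  have step1 : (∃ y : ZMod p, y ^ 8 = -4) ↔ ∃ y : (ZMod p)ˣ, y ^ 8 = u := by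
    constructor
    · rintro ⟨y, hy⟩
      have hy0 : y ≠ 0 := by
        intro h0; rw [h0, zero_pow (by norm_num)] at hy; exact h4ne hy.symm
      refine ⟨Units.mk0 y hy0, ?_⟩
      ext
      rw [Units.val_pow_eq_pow_val, Units.val_mk0, hu, Units.val_mk0]
      exact hy
    · rintro ⟨y, hy⟩
      refine ⟨(y : ZMod p), ?_⟩
      rw [← Units.val_pow_eq_pow_val, hy, hu, Units.val_mk0]
  rw [step1, exists_pow_eight_eq_iff h8 u]
  -- unfold the unit equation in ZMod p
  have step2 : u ^ ((p - 1) / 8) = 1 ↔ (-4 : ZMod p) ^ ((p - 1) / 8) = 1 := by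
    rw [← Units.val_eq_one, Units.val_pow_eq_pow_val, hu, Units.val_mk0]
  rw [step2, neg_four_pow]
  have hk : 2 * ((p - 1) / 8) = (p - 1) / 4 := by omega
  rw [hk]
  -- (−1)^k · 2^(2k) = 1 ↔ 2^(2k) = (−1)^k
  set s : ZMod p := (-1) ^ ((p - 1) / 8) with hs
  have hss : s * s = 1 := by
    rw [hs, ← mul_pow]; norm_num
  constructor
  · intro h
    calc (2 : ZMod p) ^ ((p - 1) / 4) = s * (s * 2 ^ ((p - 1) / 4)) := by
          rw [← mul_assoc, hss, one_mul]
      _ = s := by rw [h, mul_one]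
  · intro h
    rw [h, hss]

end Summit.Langlands.Langlands.Theorems.SoloBlindEighthPowers
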